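import Literature.Probability.Distributions.GaussianPoincare
import HarnessLib

/-!
# The Gaussian Poincaré inequality, variance form

`Literature/Probability/Distributions/`. A corollary file of `GaussianPoincare`: for the product
Gaussian `γ = 𝒩(0, v I_n)` on `ℝ^n` (Mathlib: `Measure.pi fun _ : Fin n => gaussianReal 0 v`)
and a bounded `C¹` function `φ : ℝ^n → ℝ` with `∫ |∇φ|² dγ < ∞`,

  `Var_γ(φ) = ∫ φ² dγ − (∫ φ dγ)² ≤ (π²/8) v ∫ |∇φ|² dγ`,   `|∇φ|² = ∑ᵢ (∂ᵢφ)²`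

(`variance_le_pi_gaussianReal`). It is obtained from the interpolation form
`∫∫ (φ x − φ y)² dγ(x)dγ(y) ≤ (π²/4) v ∫ |∇φ|² dγ` (`lintegral_sq_sub_le_pi_gaussianReal`,
stated there with Lebesgue integrals in `[0, ∞]`) and the elementary identity
`∫∫ (φ x − φ y)² dμdμ = 2∫ φ² dμ − 2(∫ φ dμ)²` for a probability measure `μ`
(`integral_integral_sq_sub`). The constant `π²/8` is the non-optimal one of the rotation
argument (the sharp constant is `1`: Chernoff 1981 / Nash 1958); it is dimension-free, which is
all that spectral-gap applications need (e.g. the coercivity of Gallay–Wayne's operator `−𝓛` in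
`L²(G⁻¹dx)`, `Literature/Analysis/FluidPDE/GaussianVortexPlanar`).

No definitions; Bochner integrals throughout, under the stated integrability hypotheses.
-/

noncomputable section

open MeasureTheory ProbabilityTheory Filter Set
open scoped ENNReal NNReal Topology

namespace Literature.Probability.Distributions

variable {n : ℕ}

/-- For a probability measure `μ` and `φ ∈ L¹ ∩ L²(μ)`:
`∫ (φ x − φ y)² dμ(y) = φ(x)² − 2φ(x)∫ φ dμ + ∫ φ² dμ`. [folklore] -/
theorem integral_sq_sub_eq {α : Type*} [MeasurableSpace α] (μ : Measure α)
    [IsProbabilityMeasure μ] {φ : α → ℝ} (h1 : Integrable φ μ)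
    (h2 : Integrable (fun x => φ x ^ 2) μ) (x : α) :
    ∫ y, (φ x - φ y) ^ 2 ∂μ = φ x ^ 2 - 2 * φ x * (∫ y, φ y ∂μ) + ∫ y, φ y ^ 2 ∂μ := by
  have e : (fun y => (φ x - φ y) ^ 2) = fun y => (φ x ^ 2 - 2 * φ x * φ y) + φ y ^ 2 := by
    funext y; ring
  have hf : Integrable (fun y => φ x ^ 2 - 2 * φ x * φ y) μ :=
    (integrable_const _).sub (h1.const_mul _)
  have hk : Integrable (fun y => 2 * φ x * φ y) μ := h1.const_mul _
  rw [e, integral_add hf h2, integral_sub (integrable_const _) hk, integral_const_mul,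
    integral_const]
  simp

/-- For a probability measure `μ` and `φ ∈ L¹ ∩ L²(μ)`:
`∫∫ (φ x − φ y)² dμ(y)dμ(x) = 2∫ φ² dμ − 2(∫ φ dμ)²` (twice the variance). [folklore] -/
theorem integral_integral_sq_sub {α : Type*} [MeasurableSpace α] (μ : Measure α)
    [IsProbabilityMeasure μ] {φ : α → ℝ} (h1 : Integrable φ μ)
    (h2 : Integrable (fun x => φ x ^ 2) μ) :
    ∫ x, ∫ y, (φ x - φ y) ^ 2 ∂μ ∂μ = 2 * ∫ x, φ x ^ 2 ∂μ - 2 * (∫ x, φ x ∂μ) ^ 2 := by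
  simp_rw [integral_sq_sub_eq μ h1 h2]
  have hf : Integrable (fun x => φ x ^ 2 - 2 * φ x * ∫ y, φ y ∂μ) μ :=
    h2.sub ((h1.const_mul 2).mul_const _)
  have hk : Integrable (fun x => 2 * φ x * ∫ y, φ y ∂μ) μ := (h1.const_mul 2).mul_const _
  rw [integral_add hf (integrable_const _), integral_sub h2 hk, integral_mul_const,
    integral_const_mul, integral_const]
  simp only [probReal_univ, smul_eq_mul, one_mul]
  ring

/-- The inner integrand `y ↦ (φ x − φ y)²` is integrable for `φ ∈ L¹ ∩ L²`. [folklore] -/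
theorem integrable_sq_sub {α : Type*} [MeasurableSpace α] (μ : Measure α)
    [IsProbabilityMeasure μ] {φ : α → ℝ} (h1 : Integrable φ μ)
    (h2 : Integrable (fun x => φ x ^ 2) μ) (c : ℝ) :
    Integrable (fun y => (c - φ y) ^ 2) μ := by
  have e : (fun y => (c - φ y) ^ 2) = fun y => (c ^ 2 - 2 * c * φ y) + φ y ^ 2 := by
    funext y; ring
  rw [e]
  exact ((integrable_const _).sub (h1.const_mul _)).add h2

/-- **The Gaussian Poincaré inequality (variance form).** For `γ = 𝒩(0, v I_n)` and a bounded
`C¹` function `φ : ℝ^n → ℝ` with `∑ᵢ (∂ᵢφ)² ∈ L¹(γ)`: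
`∫ φ² dγ − (∫ φ dγ)² ≤ (π²/8) v ∫ ∑ᵢ (∂ᵢφ)² dγ` (from the interpolation form
`lintegral_sq_sub_le_pi_gaussianReal` by Pisier's rotation argument; non-optimal dimension-free
constant `π²/8`, the sharp one being `1`). [folklore] -/
theorem variance_le_pi_gaussianReal (v : ℝ≥0) {φ : (Fin n → ℝ) → ℝ} (hφ : ContDiff ℝ 1 φ)
    {C : ℝ} (hC : ∀ x, |φ x| ≤ C)
    (hg : Integrable (fun x => ∑ i, (fderiv ℝ φ x (Pi.single i 1)) ^ 2)
      (Measure.pi fun _ : Fin n => gaussianReal 0 v)) :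
    ∫ x, φ x ^ 2 ∂(Measure.pi fun _ : Fin n => gaussianReal 0 v) -
        (∫ x, φ x ∂(Measure.pi fun _ : Fin n => gaussianReal 0 v)) ^ 2 ≤
      Real.pi ^ 2 / 8 * v *
        ∫ x, ∑ i, (fderiv ℝ φ x (Pi.single i 1)) ^ 2 ∂(Measure.pi fun _ : Fin n => gaussianReal 0 v) := by
  set γ : Measure (Fin n → ℝ) := Measure.pi fun _ : Fin n => gaussianReal 0 v with hγ
  have hφm : AEStronglyMeasurable φ γ := hφ.continuous.aestronglyMeasurable
  have h1 : Integrable φ γ :=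
    (memLp_top_of_bound hφm C (ae_of_all _ fun x => by simpa using hC x)).integrable le_top
  have h2 : Integrable (fun x => φ x ^ 2) γ := by
    refine (memLp_top_of_bound (hφ.continuous.pow 2).aestronglyMeasurable (C ^ 2)
      (ae_of_all _ fun x => ?_)).integrable le_top
    show ‖φ x ^ 2‖ ≤ C ^ 2
    rw [norm_pow, Real.norm_eq_abs]
    exact pow_le_pow_left₀ (abs_nonneg _) (hC x) 2
  set m : ℝ := ∫ x, φ x ∂γ with hm
  set s : ℝ := ∫ x, φ x ^ 2 ∂γ with hs
  set g : (Fin n → ℝ) → ℝ := fun x => ∑ i, (fderiv ℝ φ x (Pi.single i 1)) ^ 2 with hgdef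
  have hg0 : ∀ x, 0 ≤ g x := fun x => Finset.sum_nonneg fun i _ => sq_nonneg _
  -- the interpolation form, in `ℝ≥0∞`
  have key := lintegral_sq_sub_le_pi_gaussianReal v hφ
  rw [← hγ] at key
  -- convert the left side to a Bochner double integral
  have hin : ∀ x, ∫⁻ y, ENNReal.ofReal ((φ x - φ y) ^ 2) ∂γ = ENNReal.ofReal (∫ y, (φ x - φ y) ^ 2 ∂γ) :=
    fun x => (ofReal_integral_eq_lintegral_ofReal (integrable_sq_sub γ h1 h2 (φ x))
      (ae_of_all _ fun y => sq_nonneg _)).symm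
  have hout_int : Integrable (fun x => ∫ y, (φ x - φ y) ^ 2 ∂γ) γ := by
    have e : (fun x => ∫ y, (φ x - φ y) ^ 2 ∂γ) = fun x => φ x ^ 2 - 2 * φ x * m + s := by
      funext x
      rw [integral_sq_sub_eq γ h1 h2]
    rw [e]
    exact (h2.sub ((h1.const_mul 2).mul_const m)).add (integrable_const _)
  have hL : ∫⁻ x, ∫⁻ y, ENNReal.ofReal ((φ x - φ y) ^ 2) ∂γ ∂γ = ENNReal.ofReal (2 * s - 2 * m ^ 2) := by
    simp_rw [hin]
    rw [← ofReal_integral_eq_lintegral_ofReal hout_int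
      (ae_of_all _ fun x => integral_nonneg fun y => sq_nonneg _), integral_integral_sq_sub γ h1 h2]
  have hR : ∫⁻ x, ENNReal.ofReal (g x) ∂γ = ENNReal.ofReal (∫ x, g x ∂γ) :=
    (ofReal_integral_eq_lintegral_ofReal hg (ae_of_all _ hg0)).symm
  rw [hL, hR, ← ENNReal.ofReal_mul (by positivity)] at key
  have hpos : 0 ≤ Real.pi ^ 2 / 4 * (v : ℝ) * ∫ x, g x ∂γ := by
    have := integral_nonneg (μ := γ) (f := g) fun x => hg0 x
    positivity
  have := (ENNReal.ofReal_le_ofReal_iff hpos).1 key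
  rw [hs, hm] at this
  linarith

end Literature.Probability.Distributions
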